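import Summits.Ventures.YMGap.RobustBall.BallClosure
import Summits.Ventures.YMGap.RobustBall.RobustAreaLawBallW
import HarnessLib

/-!
# Venture YMGap, track ROBUST-BALL (Y2) — the torus balls are ADDITIVE in their radii
# (torus twin of `MemBallZdS.add`: `InBall`, `ClusterDomain κ`, `ClusterDomainFR` with range `max r₁ r₂`)

HONEST FRAMING. WHAT THIS IS: a venture file (cell `pub-ymgap`, track Y2 ROBUST-BALL; filed by seat rb-p1 g6 as the
post-cut micro-item «InBall.add» flagged by ym3ir-theory-1 g15, PORTED VERBATIM from §1 of ym3ir-theory-2 g12's kernel-checked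
scratch `HOME/ym3ir/lean/FormatFreeRB-theory2.scratch.lean` (sha16 2d3778a00b95adf5), namespace moved from
`…YM3IR.FormatFreeRB` to `…RobustBall` as agreed on the bus (rb-theory g16 20:09:06Z, ym3ir-theory-2 g12 20:19:45Z)).
Typed INTERFACE bookkeeping on the finite periodic lattice `(ℤ/L)^d`: the sum of two load witnesses is a load witness of
the sum (`loadWitnessAdd`), the four per-link loads are additive (`oscLoad_add`, `selfLipLoad_add`, `crossLip_add`,
`crossLipLoad_add`), hence rb-theory's tier-2 ball is additive in its radii (`inBall_add`, `clusterDomain_add`: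
`W₁ ∈ ClusterDomain κ a₁ b₁`, `W₂ ∈ ClusterDomain κ a₂ b₂` ⇒ `W₁ + W₂ ∈ ClusterDomain κ (a₁+a₂) (b₁+b₂)`), ranges combine by
`max` (`hasRange_add`) and the tier-1 ball `ClusterDomainFR` is additive with range `max r₁ r₂` (`clusterDomainFR_add`) —
the torus twin of the `ℤ^d` closure lemma `MemBallZdS.add` (`BallClosure.lean`, same witness lemmas `isOscBound_add` /
`isLipBound_add`).  Consumers: YM3-IR's format-free relabelling of the coupling (`W ↦ W + P_{β₁−β₂}`, post-GO file
`YM3IR/FormatFreeRB.lean`).  WHAT THIS IS NOT: proves no membership of any particular law, no clustering, no gap; nothing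
about the continuum limit or a Clay-sense mass gap.  Georgii (2011) §2.1 (the potentials of finite norm form a vector space).
-/

noncomputable section

open MeasureTheory Finset Function Real
open Literature.Probability.LatticeModels Literature.Probability.LatticeModels.DobrushinMetric
open Literature.MathematicalPhysics.QuantumLattice hiding torusNorm
open Literature.MathematicalPhysics.QuantumFieldTheory hiding ZdEdge

namespace Summit.Ventures.YMGap.RobustBall

variable {d L N : ℕ} [NeZero L]

/-! ### Load witnesses add -/

/-- **The sum of two load witnesses is a load witness of the sum** (oscillation and Lipschitz vectors added term by
term; `isOscBound_add`, `isLipBound_add`). -/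
def loadWitnessAdd {W₁ W₂ : Perturbation d L N} (w₁ : LoadWitness W₁) (w₂ : LoadWitness W₂) :
    LoadWitness (W₁ + W₂) where
  osc X := w₁.osc X + w₂.osc X
  lip X := w₁.lip X + w₂.lip X
  osc_spec X := by
    have h : (W₁ + W₂).act X = W₁.act X + W₂.act X := funext fun U => rfl
    rw [h]
    exact isOscBound_add (w₁.osc_spec X) (w₂.osc_spec X)
  lip_spec X := by
    have h : (W₁ + W₂).act X = W₁.act X + W₂.act X := funext fun U => rfl
    rw [h]
    exact isLipBound_add (w₁.lip_spec X) (w₂.lip_spec X)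

variable {W₁ W₂ : Perturbation d L N} (w₁ : LoadWitness W₁) (w₂ : LoadWitness W₂)

/-- The weighted oscillation load of the summed witness is the sum of the loads. -/
theorem oscLoad_add (κ : ℝ) (e : Edge d L) :
    (loadWitnessAdd w₁ w₂).oscLoad κ e = w₁.oscLoad κ e + w₂.oscLoad κ e := by
  simp only [LoadWitness.oscLoad, loadWitnessAdd, Pi.add_apply, mul_add, sum_add_distrib]

/-- The weighted self-Lipschitz load of the summed witness is the sum of the loads. -/
theorem selfLipLoad_add (κ : ℝ) (e : Edge d L) :
    (loadWitnessAdd w₁ w₂).selfLipLoad κ e = w₁.selfLipLoad κ e + w₂.selfLipLoad κ e := by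
  simp only [LoadWitness.selfLipLoad, loadWitnessAdd, Pi.add_apply, mul_add, sum_add_distrib]

/-- The weighted cross-Lipschitz entries of the summed witness are the sums of the entries. -/
theorem crossLip_add (κ : ℝ) (e y : Edge d L) :
    (loadWitnessAdd w₁ w₂).crossLip κ e y = w₁.crossLip κ e y + w₂.crossLip κ e y := by
  simp only [LoadWitness.crossLip, loadWitnessAdd, Pi.add_apply, mul_add, sum_add_distrib]

/-- The weighted cross-Lipschitz load of the summed witness is the sum of the loads. -/
theorem crossLipLoad_add (κ : ℝ) (e : Edge d L) :
    (loadWitnessAdd w₁ w₂).crossLipLoad κ e = w₁.crossLipLoad κ e + w₂.crossLipLoad κ e := by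
  simp only [LoadWitness.crossLipLoad, crossLip_add, sum_add_distrib]

/-! ### The balls are additive in their radii -/

/-- **The per-link loads are additive, so `InBall κ` is additive in `(ε₀, ε₁)`** (torus twin of `MemBallZdS.add`). -/
theorem inBall_add {κ a₁ b₁ a₂ b₂ : ℝ} (h₁ : InBall κ a₁ b₁ W₁) (h₂ : InBall κ a₂ b₂ W₂) :
    InBall κ (a₁ + a₂) (b₁ + b₂) (W₁ + W₂) := by
  obtain ⟨w₁, h₁o, h₁l⟩ := h₁
  obtain ⟨w₂, h₂o, h₂l⟩ := h₂
  refine ⟨loadWitnessAdd w₁ w₂, fun e => ?_, fun e => ?_⟩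
  · rw [oscLoad_add]
    exact add_le_add (h₁o e) (h₂o e)
  · rw [selfLipLoad_add, crossLipLoad_add]
    linarith [h₁l e, h₂l e]

/-- **`ClusterDomain κ` is additive in its radii**: `W₁ ∈ ClusterDomain κ a₁ b₁`, `W₂ ∈ ClusterDomain κ a₂ b₂` ⇒
`W₁ + W₂ ∈ ClusterDomain κ (a₁ + a₂) (b₁ + b₂)`. -/
theorem clusterDomain_add {κ a₁ b₁ a₂ b₂ : ℝ} (h₁ : W₁ ∈ ClusterDomain κ a₁ b₁)
    (h₂ : W₂ ∈ ClusterDomain κ a₂ b₂) : W₁ + W₂ ∈ ClusterDomain κ (a₁ + a₂) (b₁ + b₂) :=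
  inBall_add h₁ h₂

/-- **Ranges combine by `max`**: the sum of a range-`r₁` and a range-`r₂` perturbation has range `max r₁ r₂`. -/
theorem hasRange_add {r₁ r₂ : ℕ} (h₁ : HasRange r₁ W₁) (h₂ : HasRange r₂ W₂) : HasRange (max r₁ r₂) (W₁ + W₂) := by
  intro X hX
  funext U
  rw [QuasiLocalGaugePerturbation.add_act, h₁ X ((le_max_left _ _).trans_lt hX),
    h₂ X ((le_max_right _ _).trans_lt hX), Pi.zero_apply, add_zero]

/-- **The tier-1 ball `ClusterDomainFR` is additive in `(ε₀, ε₁)` with range `max r₁ r₂`.** -/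
theorem clusterDomainFR_add {a₁ b₁ a₂ b₂ : ℝ} {r₁ r₂ : ℕ} (h₁ : W₁ ∈ ClusterDomainFR a₁ b₁ r₁)
    (h₂ : W₂ ∈ ClusterDomainFR a₂ b₂ r₂) : W₁ + W₂ ∈ ClusterDomainFR (a₁ + a₂) (b₁ + b₂) (max r₁ r₂) :=
  ⟨hasRange_add h₁.1 h₂.1, inBall_add h₁.2 h₂.2⟩

/-- **Monotone form**: members of `ClusterDomainFR a₁ b₁ r` and `ClusterDomainFR a₂ b₂ r` (same range) sum into
`ClusterDomainFR (a₁ + a₂) (b₁ + b₂) r`. -/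
theorem clusterDomainFR_add_same {a₁ b₁ a₂ b₂ : ℝ} {r : ℕ} (h₁ : W₁ ∈ ClusterDomainFR a₁ b₁ r)
    (h₂ : W₂ ∈ ClusterDomainFR a₂ b₂ r) : W₁ + W₂ ∈ ClusterDomainFR (a₁ + a₂) (b₁ + b₂) r := by
  simpa only [max_self] using clusterDomainFR_add h₁ h₂

end Summit.Ventures.YMGap.RobustBall

end
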